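import Summits.QuantumFields.QCD.Theses.HeatSlicedQuarks
import Summits.QuantumFields.QCD.Theorems.HeatSlicedQuarksInterleavedHeatSliceFlowStubColumnIdentification
import Summits.QuantumFields.QCD.Theorems.HeatSlicedQuarksInterleavedHeatSliceFlowStubHoppingWeightedBounds
import Summits.QuantumFields.QCD.Theorems.HeatSlicedQuarksInterleavedHeatSliceFlowStubFreeColumnProfile
import Summits.QuantumFields.QCD.Theorems.HeatSlicedQuarksInterleavedHeatSliceFlowStubFreeWeightedMoments

/-!
# Helpers for stub `stub_interiorTracedAssembly` of line `Sketch`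
(crux `TracedQuadraticParametrix`, item stmt-QuantumFields-17985)

Bookkeeping lemmas for the interior traced assembly (the T*T splitting of the traced on-diagonal
correction `Φ_W(2s)` into a square term and a `τ`-integral):

* `conjTranspose_mul_self_sub_eq_left` — the vertex identity with the FREE operator on the left,
  `AᴴA − BᴴB = Bᴴ(A − B) + (A − B)ᴴA`;
* `heat_vertex_split` — with `K₁ = e^{-σBᴴB}` (Hermitian) and `E = A − B`:
  `K₁ (AᴴA − BᴴB) Y = (EᴴBK₁)ᴴ Y + (EK₁)ᴴ (AY)`;
* `norm_conjTranspose_mul_apply_self_le` — Cauchy–Schwarz for the diagonal entry `(XᴴY)(p,p)`;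
* `second_order_entry_bound` — the two combined:
  `|(K₁(σ)(AᴴA − BᴴB)Y)(p,p)| ≤ ‖EᴴBK₁(σ)e_p‖₂ ‖Ye_p‖₂ + ‖EK₁(σ)e_p‖₂ ‖AYe_p‖₂`;
* `continuousOn_sandwich_entry` — continuity of `τ ↦ (e^{-(t−τ)H₁}(H − H₁)e^{-τH})(i,j)` (8871's
  `rowDuhamel_continuousOn_entry` with the constant weight);
* `norm_integral_le_of_inv_sqrt_bound` — if `‖F(τ)‖ ≤ P/√(1+τ) + Q` on `[0,s]` (`P ≥ 0`) then
  `‖∫₀ˢ F‖ ≤ 2P√(1+s) + Qs`;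
* `hopping_column_bounds` — the two `ℓ²` bounds of the hopping perturbation `E = D_W(W) − D_W(1)` applied to the
  free column at the centre `x` of a linear link-deficit profile `3 − Re tr W(z,μ) ≤ C_A(d(x,z)+1)²δ²`:
  `‖E K₁(σ)e_{(x,a,α)}‖₂ ≤ δA₁/√(1+σ)`, `‖EᴴD_1K₁(σ)e_{(x,a,α)}‖₂ ≤ δA₁/(1+σ)` for `0 ≤ σ ≤ L²` — exactly the two
  vertex bounds in the proof of the landed `stub_columnIdentification`, from the landed `stub_hoppingWeightedBounds`,
  `stub_freeColumnProfile`, `stub_freeWeightedMoments`.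

No named facts beyond the landed theorems quoted.
-/

noncomputable section

namespace Summit.QuantumFields.QCD.Cruxes.TracedQuadraticParametrix.Sketch

open Literature.MathematicalPhysics.QuantumLattice Literature.MathematicalPhysics.QuantumFieldTheory
  Literature.Probability.LatticeModels
open Summit.QuantumFields.QCD.Theses.HeatSlicedQuarks
open Summit.QuantumFields.QCD.Theorems.SmallFieldUltracontractivity.Negative
open Summit.QuantumFields.QCD.Cruxes.SmallFieldUltracontractivity.PointCentredAxialParabolic
open Summit.QuantumFields.QCD.Cruxes.InterleavedHeatSliceFlow.Sketch
open MeasureTheory intervalIntegral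
open scoped Matrix ComplexConjugate

section MatrixAlgebra

variable {ι : Type} [Fintype ι]

/-- The vertex identity with the free operator on the left: `AᴴA − BᴴB = Bᴴ(A − B) + (A − B)ᴴA`. -/
theorem conjTranspose_mul_self_sub_eq_left (A B : Matrix ι ι ℂ) :
    Aᴴ * A - Bᴴ * B = Bᴴ * (A - B) + (A - B)ᴴ * A := by
  rw [Matrix.conjTranspose_sub, Matrix.mul_sub, Matrix.sub_mul]
  abel

/-- **Cauchy–Schwarz for a diagonal entry of `XᴴY`**: `|(XᴴY)(p,p)| ≤ ‖Xe_p‖₂ ‖Ye_p‖₂`. -/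
theorem norm_conjTranspose_mul_apply_self_le (X Y : Matrix ι ι ℂ) (p : ι) :
    ‖(Xᴴ * Y) p p‖ ≤ Real.sqrt (∑ q, ‖X q p‖ ^ 2) * Real.sqrt (∑ q, ‖Y q p‖ ^ 2) := by
  rw [Matrix.mul_apply]
  simp only [Matrix.conjTranspose_apply]
  exact norm_sum_conj_mul_le (fun q => X q p) (fun q => Y q p)

variable [DecidableEq ι]

/-- **Splitting of the sandwiched vertex.**  With `K₁ = e^{-σBᴴB}` (Hermitian) and `E = A − B`:
`K₁ (AᴴA − BᴴB) Y = (Eᴴ B K₁)ᴴ Y + (E K₁)ᴴ (A Y)`. -/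
theorem heat_vertex_split (A B Y : Matrix ι ι ℂ) (σ : ℝ) :
    NormedSpace.exp (-(σ : ℂ) • (Bᴴ * B)) * (Aᴴ * A - Bᴴ * B) * Y =
      ((A - B)ᴴ * B * NormedSpace.exp (-(σ : ℂ) • (Bᴴ * B)))ᴴ * Y +
        ((A - B) * NormedSpace.exp (-(σ : ℂ) • (Bᴴ * B)))ᴴ * (A * Y) := by
  have hK : (NormedSpace.exp (-(σ : ℂ) • (Bᴴ * B)))ᴴ = NormedSpace.exp (-(σ : ℂ) • (Bᴴ * B)) :=
    (isHermitian_exp_neg_smul B σ).eq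
  simp only [Matrix.conjTranspose_mul, Matrix.conjTranspose_conjTranspose, hK]
  rw [conjTranspose_mul_self_sub_eq_left]
  simp only [Matrix.mul_add, Matrix.add_mul, Matrix.mul_assoc]

/-- **Second-order entry bound**: for `K₁(σ) = e^{-σBᴴB}`, `E = A − B` and any `Y`,
`|(K₁(σ)(AᴴA − BᴴB)Y)(p,p)| ≤ ‖EᴴBK₁(σ)e_p‖₂ ‖Ye_p‖₂ + ‖EK₁(σ)e_p‖₂ ‖AYe_p‖₂`. -/
theorem second_order_entry_bound (A B Y : Matrix ι ι ℂ) (σ : ℝ) (p : ι) :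
    ‖(NormedSpace.exp (-(σ : ℂ) • (Bᴴ * B)) * (Aᴴ * A - Bᴴ * B) * Y) p p‖ ≤
      Real.sqrt (∑ q, ‖((A - B)ᴴ.mulVec (B.mulVec fun k => NormedSpace.exp (-(σ : ℂ) • (Bᴴ * B)) k p)) q‖ ^ 2) *
          Real.sqrt (∑ q, ‖Y q p‖ ^ 2) +
        Real.sqrt (∑ q, ‖((A - B).mulVec fun k => NormedSpace.exp (-(σ : ℂ) • (Bᴴ * B)) k p) q‖ ^ 2) *
          Real.sqrt (∑ q, ‖(A * Y) q p‖ ^ 2) := by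
  rw [heat_vertex_split, Matrix.add_apply]
  refine (norm_add_le _ _).trans (add_le_add ?_ ?_)
  · refine (norm_conjTranspose_mul_apply_self_le _ _ p).trans (le_of_eq ?_)
    congr 2
    refine Finset.sum_congr rfl fun q _ => ?_
    rw [mul_apply_eq_mulVec, ← Matrix.mulVec_mulVec]
  · -- `((A - B) K₁) q p` is definitionally `((A - B).mulVec (K₁ e_p)) q`
    exact (norm_conjTranspose_mul_apply_self_le _ _ p).trans (le_of_eq rfl)

/-- **Continuity of the two-time sandwich, entrywise**: for square matrices `H₁, H` and indices `i, j`, the function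
`τ ↦ (e^{-(t−τ)H₁} (H − H₁) e^{-τH})(i,j)` is continuous (on any set). -/
theorem continuousOn_sandwich_entry (H₁ H : Matrix ι ι ℂ) (t : ℝ) (S : Set ℝ) (i j : ι) :
    ContinuousOn (fun τ : ℝ => (NormedSpace.exp (-((t - τ : ℝ) : ℂ) • H₁) * (H - H₁) *
      NormedSpace.exp (-(τ : ℂ) • H)) i j) S := by
  have h := rowDuhamel_continuousOn_entry H₁ H (1 : Matrix ι ι ℂ) t (θ := fun _ => (1 : ℝ))
    (θ' := fun _ => (0 : ℝ)) (S := S) continuousOn_const continuousOn_const i j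
  refine h.neg.congr fun τ _ => ?_
  simp only [Matrix.mul_one, Matrix.one_mul, Complex.ofReal_one, Complex.ofReal_zero, one_smul, zero_smul,
    add_zero, Pi.neg_apply]
  rw [← Matrix.neg_apply, ← neg_mul, ← mul_neg, neg_sub]

end MatrixAlgebra

/-! ### One elementary time integral -/

/-- `∫₀ˢ dτ/√(1+τ) ≤ 2√(1+s)` for `s ≥ 0`. -/
theorem integral_inv_sqrt_one_add_le_two {s : ℝ} (hs : 0 ≤ s) :
    ∫ τ in (0:ℝ)..s, 1 / Real.sqrt (1 + τ) ≤ 2 * Real.sqrt (1 + s) := by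
  have h := integral_inv_sqrt_one_add_mul_le one_pos hs
  simpa only [one_mul, div_one] using h

/-- **Norm of a `τ`-integral under a `P/√(1+τ) + Q` majorant**: if `‖F(τ)‖ ≤ P/√(1+τ) + Q` for `τ ∈ [0,s]`
(`s, P ≥ 0`), then `‖∫₀ˢ F‖ ≤ 2P√(1+s) + Qs`. -/
theorem norm_integral_le_of_inv_sqrt_bound {F : ℝ → ℂ} {s P Q : ℝ} (hs : 0 ≤ s) (hP : 0 ≤ P)
    (hb : ∀ τ ∈ Set.Icc (0:ℝ) s, ‖F τ‖ ≤ P / Real.sqrt (1 + τ) + Q) :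
    ‖∫ τ in (0:ℝ)..s, F τ‖ ≤ 2 * P * Real.sqrt (1 + s) + Q * s := by
  have hcont : ContinuousOn (fun τ : ℝ => 1 / Real.sqrt (1 + τ)) (Set.Icc 0 s) := by
    refine ContinuousOn.div continuousOn_const (by fun_prop) fun u hu => ?_
    exact (Real.sqrt_pos.mpr (by linarith [hu.1])).ne'
  have hint1 : IntervalIntegrable (fun τ : ℝ => 1 / Real.sqrt (1 + τ)) volume 0 s :=
    hcont.intervalIntegrable_of_Icc hs
  have hintP : IntervalIntegrable (fun τ : ℝ => P * (1 / Real.sqrt (1 + τ))) volume 0 s :=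
    hint1.const_mul P
  have hintQ : IntervalIntegrable (fun _ : ℝ => Q) volume 0 s := intervalIntegrable_const
  have hle : ‖∫ τ in (0:ℝ)..s, F τ‖ ≤ ∫ τ in (0:ℝ)..s, (P * (1 / Real.sqrt (1 + τ)) + Q) := by
    refine norm_integral_le_of_norm_le hs (Filter.Eventually.of_forall fun τ hτ => ?_) (hintP.add hintQ)
    rw [mul_one_div]
    exact hb τ ⟨hτ.1.le, hτ.2⟩
  refine hle.trans ?_
  rw [integral_add hintP hintQ, intervalIntegral.integral_const_mul, intervalIntegral.integral_const, smul_eq_mul,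
    sub_zero]
  have hI := mul_le_mul_of_nonneg_left (integral_inv_sqrt_one_add_le_two hs) hP
  linarith

/-! ### The hopping perturbation on the free column -/

set_option maxHeartbeats 800000 in
/-- **Hopping bounds on the free column at the centre of the comb.**  In a gauge with
`3 − Re tr W(z,μ) ≤ C_A (d(x,z)+1)² δ²` (`δ ≥ 0`), with `E = D_W(W) − D_W(1)` and `K₁(σ) = e^{-σD_1ᴴD_1}`,
for `0 ≤ σ ≤ L²`:  `‖E K₁(σ) e_{(x,a,α)}‖₂ ≤ δA₁/√(1+σ)` and `‖Eᴴ D_1 K₁(σ) e_{(x,a,α)}‖₂ ≤ δA₁/(1+σ)`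
(landed hopping bounds (1),(2) + free column profiles + weighted moments (3a),(3b)). -/
theorem hopping_column_bounds {C_A : ℝ} (hCA : 0 ≤ C_A) :
    ∃ A₁ : ℝ, 0 ≤ A₁ ∧ ∀ (L : ℕ) [NeZero L] (W : GaugeConfig 4 L (Matrix.specialUnitaryGroup (Fin 3) ℂ))
      (m : ℝ), m ∈ Set.Icc (-(1 / 2 : ℝ)) 1 → ∀ (x : TorusSite 4 L) (δ : ℝ), 0 ≤ δ →
      (∀ (z : TorusSite 4 L) (μ : Fin 4),
        3 - ((fundamentalRep (Fin 3)) (W (z, μ))).trace.re ≤ C_A * ((torusDist x z : ℝ) + 1) ^ 2 * δ ^ 2) →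
      ∀ σ : ℝ, 0 ≤ σ → σ ≤ (L : ℝ) ^ 2 → ∀ (a : Fin 3) (α : Fin 4),
        Real.sqrt (∑ q, ‖((wilsonDirac (fundamentalRep (Fin 3)) W m 1 -
            wilsonDirac (fundamentalRep (Fin 3))
              (fun _ : Edge 4 L => (1 : Matrix.specialUnitaryGroup (Fin 3) ℂ)) m 1).mulVec
            fun k => (NormedSpace.exp (-(σ : ℂ) •
              ((wilsonDirac (fundamentalRep (Fin 3))
                  (fun _ : Edge 4 L => (1 : Matrix.specialUnitaryGroup (Fin 3) ℂ)) m 1)ᴴ *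
                wilsonDirac (fundamentalRep (Fin 3))
                  (fun _ : Edge 4 L => (1 : Matrix.specialUnitaryGroup (Fin 3) ℂ)) m 1))) k (x, a, α)) q‖ ^ 2) ≤
          δ * A₁ / Real.sqrt (1 + σ) ∧
        Real.sqrt (∑ q, ‖((wilsonDirac (fundamentalRep (Fin 3)) W m 1 -
            wilsonDirac (fundamentalRep (Fin 3))
              (fun _ : Edge 4 L => (1 : Matrix.specialUnitaryGroup (Fin 3) ℂ)) m 1)ᴴ.mulVec
            ((wilsonDirac (fundamentalRep (Fin 3))
                (fun _ : Edge 4 L => (1 : Matrix.specialUnitaryGroup (Fin 3) ℂ)) m 1).mulVec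
              fun k => (NormedSpace.exp (-(σ : ℂ) •
                ((wilsonDirac (fundamentalRep (Fin 3))
                    (fun _ : Edge 4 L => (1 : Matrix.specialUnitaryGroup (Fin 3) ℂ)) m 1)ᴴ *
                  wilsonDirac (fundamentalRep (Fin 3))
                    (fun _ : Edge 4 L => (1 : Matrix.specialUnitaryGroup (Fin 3) ℂ)) m 1))) k (x, a, α))) q‖ ^ 2) ≤
          δ * A₁ / (1 + σ) := by
  obtain ⟨C_H0, hH0⟩ := stub_hoppingWeightedBounds C_A hCA
  obtain ⟨C_F0, c_F, hcF, hF0⟩ := stub_freeColumnProfile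
  obtain ⟨M0, hM0⟩ := stub_freeWeightedMoments
  -- nonnegative versions of the constants
  set C_H : ℝ := max C_H0 0 with hCH
  set C_F : ℝ := max C_F0 0 with hCF
  set M : ℝ := max M0 0 with hMdef
  have hCH0 : 0 ≤ C_H := le_max_right _ _
  have hCF0 : 0 ≤ C_F := le_max_right _ _
  have hM00 : 0 ≤ M := le_max_right _ _
  set A₁ : ℝ := Real.sqrt (C_H * (12 * C_F ^ 2 * M)) with hA₁
  refine ⟨A₁, Real.sqrt_nonneg _, ?_⟩
  intro L _ W m hm x δ hδ0 hprof σ hσ0 hσL a α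
  set D : Matrix (TorusSite 4 L × Fin 3 × Fin 4) (TorusSite 4 L × Fin 3 × Fin 4) ℂ :=
    wilsonDirac (fundamentalRep (Fin 3)) W m 1 with hD
  set D₁ : Matrix (TorusSite 4 L × Fin 3 × Fin 4) (TorusSite 4 L × Fin 3 × Fin 4) ℂ :=
    wilsonDirac (fundamentalRep (Fin 3)) (fun _ : Edge 4 L => (1 : Matrix.specialUnitaryGroup (Fin 3) ℂ)) m 1
    with hD₁
  let col : (TorusSite 4 L × Fin 3 × Fin 4) → ℂ := fun k => (NormedSpace.exp (-(σ : ℂ) • (D₁ᴴ * D₁))) k (x, a, α)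
  show Real.sqrt (∑ q, ‖((D - D₁).mulVec col) q‖ ^ 2) ≤ δ * A₁ / Real.sqrt (1 + σ) ∧
    Real.sqrt (∑ q, ‖((D - D₁)ᴴ.mulVec (D₁.mulVec col)) q‖ ^ 2) ≤ δ * A₁ / (1 + σ)
  /- 1. free column profiles (mass factor dropped) and their weighted moments -/
  have h1F : C_F0 * Real.exp (-(c_F * σ * m ^ 2)) ≤ C_F := by
    have hexp : Real.exp (-(c_F * σ * m ^ 2)) ≤ 1 := by
      rw [Real.exp_le_one_iff]
      have : 0 ≤ c_F * σ * m ^ 2 := by have := hcF.le; positivity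
      linarith
    rcases le_or_gt 0 C_F0 with hc | hc
    · exact (mul_le_of_le_one_right hc hexp).trans (le_max_left _ _)
    · exact (mul_nonpos_of_nonpos_of_nonneg hc.le (Real.exp_pos _).le).trans hCF0
  have hprofile : ∀ z b β,
      ‖col (z, b, β)‖ ≤ C_F * ((1 + σ) / (1 + σ + (torusDist x z : ℝ) ^ 2) ^ 3) ∧
      ‖(D₁.mulVec col) (z, b, β)‖ ≤ C_F * (Real.sqrt (1 + σ) / (1 + σ + (torusDist x z : ℝ) ^ 2) ^ 3) := by
    intro z b β
    have h := hF0 L m hm σ hσ0 hσL x z a b α β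
    constructor
    · refine h.1.trans ?_
      rw [mul_div_assoc]
      exact mul_le_mul_of_nonneg_right h1F (by positivity)
    · have hmv : (D₁.mulVec col) (z, b, β) = (D₁ * NormedSpace.exp (-(σ : ℂ) • (D₁ᴴ * D₁))) (z, b, β) (x, a, α) :=
        (mul_apply_eq_mulVec D₁ _ _ _).symm
      rw [hmv]
      refine h.2.trans ?_
      rw [mul_div_assoc]
      exact mul_le_mul_of_nonneg_right h1F (by positivity)
  have hw0 : ∀ z : TorusSite 4 L, 0 ≤ ((torusDist x z : ℝ) + 3) ^ 2 := fun z => by positivity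
  have hmomA : ∑ q : TorusSite 4 L × Fin 3 × Fin 4, ((torusDist x q.1 : ℝ) + 3) ^ 2 * ‖col q‖ ^ 2 ≤
      12 * C_F ^ 2 * (M / (1 + σ)) := by
    refine (sum_weight_norm_sq_le_of_profile col (fun z => ((torusDist x z : ℝ) + 3) ^ 2)
      (fun z => (1 + σ) / (1 + σ + (torusDist x z : ℝ) ^ 2) ^ 3) hw0
      (fun z b β => (hprofile z b β).1)).trans ?_
    refine mul_le_mul_of_nonneg_left (((hM0 L x σ hσ0).1).trans ?_) (by positivity)
    exact div_le_div_of_nonneg_right (le_max_left _ _) (by linarith)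
  have hmomB : ∑ q : TorusSite 4 L × Fin 3 × Fin 4, ((torusDist x q.1 : ℝ) + 3) ^ 2 * ‖(D₁.mulVec col) q‖ ^ 2 ≤
      12 * C_F ^ 2 * (M / (1 + σ) ^ 2) := by
    refine (sum_weight_norm_sq_le_of_profile (D₁.mulVec col) (fun z => ((torusDist x z : ℝ) + 3) ^ 2)
      (fun z => Real.sqrt (1 + σ) / (1 + σ + (torusDist x z : ℝ) ^ 2) ^ 3) hw0
      (fun z b β => (hprofile z b β).2)).trans ?_
    refine mul_le_mul_of_nonneg_left (((hM0 L x σ hσ0).2.1).trans ?_) (by positivity)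
    exact div_le_div_of_nonneg_right (le_max_left _ _) (by positivity)
  /- 2. the hopping bounds -/
  have hHop' := hH0 L W m x δ hδ0 hprof
  constructor
  · have h1 := (hHop' col).1
    have h2 : C_H0 * δ ^ 2 * ∑ q, ((torusDist x q.1 : ℝ) + 3) ^ 2 * ‖col q‖ ^ 2 ≤
        C_H * δ ^ 2 * (12 * C_F ^ 2 * (M / (1 + σ))) := by
      have hS0 : 0 ≤ ∑ q : TorusSite 4 L × Fin 3 × Fin 4, ((torusDist x q.1 : ℝ) + 3) ^ 2 * ‖col q‖ ^ 2 :=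
        Finset.sum_nonneg fun q _ => by positivity
      calc C_H0 * δ ^ 2 * ∑ q, ((torusDist x q.1 : ℝ) + 3) ^ 2 * ‖col q‖ ^ 2
          ≤ C_H * δ ^ 2 * ∑ q, ((torusDist x q.1 : ℝ) + 3) ^ 2 * ‖col q‖ ^ 2 :=
            mul_le_mul_of_nonneg_right (mul_le_mul_of_nonneg_right (le_max_left _ _) (sq_nonneg _)) hS0
        _ ≤ C_H * δ ^ 2 * (12 * C_F ^ 2 * (M / (1 + σ))) :=
            mul_le_mul_of_nonneg_left hmomA (by positivity)
    have h3 : C_H * δ ^ 2 * (12 * C_F ^ 2 * (M / (1 + σ))) = δ ^ 2 * (C_H * (12 * C_F ^ 2 * M)) / (1 + σ) := by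
      ring
    calc Real.sqrt (∑ q, ‖((D - D₁).mulVec col) q‖ ^ 2)
        ≤ Real.sqrt (δ ^ 2 * (C_H * (12 * C_F ^ 2 * M)) / (1 + σ)) :=
          Real.sqrt_le_sqrt (by rw [← h3]; exact h1.trans h2)
      _ = δ * A₁ / Real.sqrt (1 + σ) := by rw [sqrt_sq_mul_div hδ0 (by linarith)]
  · have h1 := (hHop' (D₁.mulVec col)).2.1
    have h2 : C_H0 * δ ^ 2 * ∑ q, ((torusDist x q.1 : ℝ) + 3) ^ 2 * ‖(D₁.mulVec col) q‖ ^ 2 ≤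
        C_H * δ ^ 2 * (12 * C_F ^ 2 * (M / (1 + σ) ^ 2)) := by
      have hS0 : 0 ≤ ∑ q : TorusSite 4 L × Fin 3 × Fin 4,
          ((torusDist x q.1 : ℝ) + 3) ^ 2 * ‖(D₁.mulVec col) q‖ ^ 2 :=
        Finset.sum_nonneg fun q _ => by positivity
      calc C_H0 * δ ^ 2 * ∑ q, ((torusDist x q.1 : ℝ) + 3) ^ 2 * ‖(D₁.mulVec col) q‖ ^ 2
          ≤ C_H * δ ^ 2 * ∑ q, ((torusDist x q.1 : ℝ) + 3) ^ 2 * ‖(D₁.mulVec col) q‖ ^ 2 :=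
            mul_le_mul_of_nonneg_right (mul_le_mul_of_nonneg_right (le_max_left _ _) (sq_nonneg _)) hS0
        _ ≤ C_H * δ ^ 2 * (12 * C_F ^ 2 * (M / (1 + σ) ^ 2)) :=
            mul_le_mul_of_nonneg_left hmomB (by positivity)
    have h3 : C_H * δ ^ 2 * (12 * C_F ^ 2 * (M / (1 + σ) ^ 2)) =
        δ ^ 2 * (C_H * (12 * C_F ^ 2 * M)) / (1 + σ) ^ 2 := by ring
    have h1σ : 0 ≤ 1 + σ := by linarith
    calc Real.sqrt (∑ q, ‖((D - D₁)ᴴ.mulVec (D₁.mulVec col)) q‖ ^ 2)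
        ≤ Real.sqrt (δ ^ 2 * (C_H * (12 * C_F ^ 2 * M)) / (1 + σ) ^ 2) :=
          Real.sqrt_le_sqrt (by rw [← h3]; exact h1.trans h2)
      _ = δ * A₁ / (1 + σ) := by rw [sqrt_sq_mul_div hδ0 (by positivity), Real.sqrt_sq h1σ]

/-- **Registered form (stub `stub_hoppingColumnBounds` of the crux item)**: `hopping_column_bounds` with the
constant `C_A` quantified explicitly — the two `ℓ²` bounds of the hopping perturbation on the free column at the
centre of a linear link-deficit profile. -/
theorem stub_hoppingColumnBounds :
    ∀ C_A : ℝ, 0 ≤ C_A → ∃ A₁ : ℝ, 0 ≤ A₁ ∧ ∀ (L : ℕ) [NeZero L]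
      (W : GaugeConfig 4 L (Matrix.specialUnitaryGroup (Fin 3) ℂ)) (m : ℝ), m ∈ Set.Icc (-(1 / 2 : ℝ)) 1 →
      ∀ (x : TorusSite 4 L) (δ : ℝ), 0 ≤ δ →
      (∀ (z : TorusSite 4 L) (μ : Fin 4),
        3 - ((fundamentalRep (Fin 3)) (W (z, μ))).trace.re ≤ C_A * ((torusDist x z : ℝ) + 1) ^ 2 * δ ^ 2) →
      ∀ σ : ℝ, 0 ≤ σ → σ ≤ (L : ℝ) ^ 2 → ∀ (a : Fin 3) (α : Fin 4),
        Real.sqrt (∑ q, ‖((wilsonDirac (fundamentalRep (Fin 3)) W m 1 -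
            wilsonDirac (fundamentalRep (Fin 3))
              (fun _ : Edge 4 L => (1 : Matrix.specialUnitaryGroup (Fin 3) ℂ)) m 1).mulVec
            fun k => (NormedSpace.exp (-(σ : ℂ) •
              ((wilsonDirac (fundamentalRep (Fin 3))
                  (fun _ : Edge 4 L => (1 : Matrix.specialUnitaryGroup (Fin 3) ℂ)) m 1)ᴴ *
                wilsonDirac (fundamentalRep (Fin 3))
                  (fun _ : Edge 4 L => (1 : Matrix.specialUnitaryGroup (Fin 3) ℂ)) m 1))) k (x, a, α)) q‖ ^ 2) ≤
          δ * A₁ / Real.sqrt (1 + σ) ∧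
        Real.sqrt (∑ q, ‖((wilsonDirac (fundamentalRep (Fin 3)) W m 1 -
            wilsonDirac (fundamentalRep (Fin 3))
              (fun _ : Edge 4 L => (1 : Matrix.specialUnitaryGroup (Fin 3) ℂ)) m 1)ᴴ.mulVec
            ((wilsonDirac (fundamentalRep (Fin 3))
                (fun _ : Edge 4 L => (1 : Matrix.specialUnitaryGroup (Fin 3) ℂ)) m 1).mulVec
              fun k => (NormedSpace.exp (-(σ : ℂ) •
                ((wilsonDirac (fundamentalRep (Fin 3))
                    (fun _ : Edge 4 L => (1 : Matrix.specialUnitaryGroup (Fin 3) ℂ)) m 1)ᴴ *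
                  wilsonDirac (fundamentalRep (Fin 3))
                    (fun _ : Edge 4 L => (1 : Matrix.specialUnitaryGroup (Fin 3) ℂ)) m 1))) k (x, a, α))) q‖ ^ 2) ≤
          δ * A₁ / (1 + σ) :=
  fun _ hCA => hopping_column_bounds hCA

end Summit.QuantumFields.QCD.Cruxes.TracedQuadraticParametrix.Sketch

end
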